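import Mathlib
import Summits.Ventures.HodgeRepro.Tier4.Target
import Summits.Ventures.HodgeRepro.Tier4.Line3.Defs
import Summits.Ventures.HodgeRepro.Tier4.Line3.DefsLemmas
import Summits.Ventures.HodgeRepro.Tier4.Line3.LocaliserS
import Summits.Ventures.HodgeRepro.Tier4.Line3.HeckeEquivarianceLemmas
import Summits.Ventures.HodgeRepro.Tier4.Line3.InvariantMajorantDef
import Summits.Ventures.HodgeRepro.Tier4.Line3.InvariantClassBound
import Summits.Ventures.HodgeRepro.Tier4.Line3.GrowthInvOfGauss
import Summits.Ventures.HodgeRepro.Tier4.Line3.GrowthInvOfMajorant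
import Summits.Ventures.HodgeRepro.Tier4.Line3.CoefMajorantWitness
import Summits.Ventures.HodgeRepro.Tier4.Line3.ContentIdeal
import Summits.Ventures.HodgeRepro.Tier4.Line3.ContentWitness
import Summits.Ventures.HodgeRepro.Tier4.Line3.RayClassBound

/-!
# Tier4/Line3/GrowthOn — the content chain on a bare `(level, loc)`: `LocSizeOn`, `RepDenomOn`, `HasCoefMajorantOn`
and `GrowthInvOn` from `ContentBound`

Blind re-derivation cell `pub-hodge-repro`, Tier 4 «PROVE THE STEP» (README §9–§10), LINE L3, lemma L3.5;
seat t4-L2-p3 (gen 3).  The growth chain of this seat — `growthInv_of_coefMajorant` (p676532),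
`hasCoefMajorant_of_content` (p676981), `contentNorm_mulVec_le_of_repDenom` (p677459),
`hasCoefMajorant_of_contentBound` (p677665) — was stated on a localiser `ℓ : LocS`, which O-L3-8 voids; every one of
those theorems reads only `ℓ.level` and `ℓ.loc`.  This module re-states the clauses and the chain on a bare pair
`(level, loc)` (the proofs are the landed ones, the structure projections replaced by the pair):

* `LocSizeOn loc`, `RepDenomOn p loc`, `HasCoefMajorantOn D loc` — the bodies of `LocSize`, `RepDenom`,
  `HasCoefMajorant` on `loc` (`…_iff` lemmas: the `LocS` clauses are these at `ℓ.loc`, by `Iff.rfl`);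
* `growthInvOn_of_coefMajorantOn : LocSizeOn → HasCoefMajorantOn → GrowthInvOn`;
* `hasCoefMajorantOn_of_content`, `contentNorm_mulVec_le_of_repDenomOn`, `hasCoefMajorantOn_of_contentBound`;
* **`growthInvOn_of_contentBound : LocSizeOn loc → RepDenomOn p loc → ContentBound D C e′ → GrowthInvOn D loc`** —
  the print's three clauses (size and depth of the localiser, the content bound on the theta coefficients) give the
  growth clause that `FamilyClassBound` / `FamilyLit` consume.

No printed input is consumed; nothing here asserts anything about the truth of (P); HC_CM is NOT proved by anyone
in this repository.
-/

set_option autoImplicit false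

noncomputable section

namespace Summit.Ventures.HodgeRepro.Tier4.Line3

open Summit.Ventures.HodgeRepro.Tier4
open Matrix NumberField
open scoped ComplexConjugate

namespace T4Data

variable (X : T4Data)

/-! ### 1. The clauses on a bare pair -/

/-- The size clause on `(level, loc)`: the ℓ¹-size of the depth-`N` combination is `≤ B q₂^N`. -/
def LocSizeOn {level : ℕ → X.Level} (loc : ∀ N, X.Tr (level N)) : Prop :=
  ∃ B q₂ : ℝ, 0 ≤ B ∧ 0 ≤ q₂ ∧ ∀ N, X.trSize (loc N) ≤ B * q₂ ^ N

/-- `LocSize` of a localiser is `LocSizeOn` of its `loc`. -/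
theorem locSize_iff_locSizeOn (D : X.ThetaData) {p : IsDedekindDomain.HeightOneSpectrum (RingOfIntegers X.E)}
    {L₀ : Submodule (RingOfIntegers X.E) (Fin 3 → X.E)} {xm : X.Tuple} (ℓ : X.LocS D p L₀ xm) :
    X.LocSize D ℓ ↔ X.LocSizeOn ℓ.loc := Iff.rfl

/-- The depth clause on `(level, loc)`: every representative of the depth-`N` combination has an inverse with entries
in `((𝔭 𝔭̄)^N)⁻¹`. -/
def RepDenomOn (p : IsDedekindDomain.HeightOneSpectrum (RingOfIntegers X.E))
    {level : ℕ → X.Level} (loc : ∀ N, X.Tr (level N)) : Prop :=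
  ∀ N r, X.IsRepOf (loc N) r → ∃ r' : Matrix (Fin 3) (Fin 3) X.E, r' * r = 1 ∧
    ∀ i j, r' i j ∈ (X.depthIdeal p N)⁻¹

/-- `RepDenom` of a localiser is `RepDenomOn` of its `loc`. -/
theorem repDenom_iff_repDenomOn (D : X.ThetaData) {p : IsDedekindDomain.HeightOneSpectrum (RingOfIntegers X.E)}
    {L₀ : Submodule (RingOfIntegers X.E) (Fin 3 → X.E)} {xm : X.Tuple} (ℓ : X.LocS D p L₀ xm) :
    X.RepDenom D ℓ ↔ X.RepDenomOn p ℓ.loc := Iff.rfl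

/-- The majorant clause on `(level, loc)`: a non-negative `Γ`-invariant majorant of the theta coefficients, moved by
`q₃^N` under the depth-`N` representatives, of polynomial–Gaussian size. -/
def HasCoefMajorantOn (D : X.ThetaData) {level : ℕ → X.Level} (loc : ∀ N, X.Tr (level N)) : Prop :=
  ∃ (m : (Fin 3 → X.E) → ℝ) (C q₃ e c₁ : ℝ), 0 ≤ C ∧ 0 ≤ q₃ ∧ 0 < c₁ ∧
    (∀ x, 0 ≤ m x) ∧
    (∀ j x, ‖D.cf j x‖ ≤ C * m x) ∧
    (∀ γ ∈ X.Γ, ∀ x, m (γ *ᵥ x) = m x) ∧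
    (∀ N r, X.IsRepOf (loc N) r → ∀ x, m (r *ᵥ x) ≤ q₃ ^ N * m x) ∧
    (∀ x, m x ≤ (1 + ‖X.ballCoord x‖) ^ e * X.gaussDefAt c₁ x)

/-- `HasCoefMajorant` of a localiser is `HasCoefMajorantOn` of its `loc`. -/
theorem hasCoefMajorant_iff_hasCoefMajorantOn (D : X.ThetaData)
    {p : IsDedekindDomain.HeightOneSpectrum (RingOfIntegers X.E)}
    {L₀ : Submodule (RingOfIntegers X.E) (Fin 3 → X.E)} {xm : X.Tuple} (ℓ : X.LocS D p L₀ xm) :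
    X.HasCoefMajorant D ℓ ↔ X.HasCoefMajorantOn D ℓ.loc := Iff.rfl

/-! ### 2. The growth clause from the majorant clause -/

/-- **`GrowthInvOn` FROM `LocSizeOn` AND `HasCoefMajorantOn`** (p676532's `growthInv_of_coefMajorant` on the pair). -/
theorem growthInvOn_of_coefMajorantOn (D : X.ThetaData) {level : ℕ → X.Level} (loc : ∀ N, X.Tr (level N))
    (hsize : X.LocSizeOn loc) (hmaj : X.HasCoefMajorantOn D loc) : X.GrowthInvOn D loc := by
  obtain ⟨Bs, qs, hBs, hqs, hsz⟩ := hsize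
  obtain ⟨m, C, q₃, e, c₁, hC, hq₃, hc₁, hm0, hcf, hmΓ, hmH, hmA⟩ := hmaj
  obtain ⟨R, hR1, hR⟩ := X.exists_uniform_comparability_rev
  have hRpos : 0 < R := zero_lt_one.trans_le hR1
  refine ⟨Bs * C ^ 4, qs * q₃ ^ 4, e, c₁ / (2 * R), by positivity, by positivity, fun N w g => ?_⟩
  have hmain := X.norm_coefQ_le_trSize D (loc N) hm0 hcf hC hq₃ (hmH N) (X.rep w)
  have hprod := X.prod_majorant_le_quadMaj hc₁ hm0 hmΓ hmA hR1 hR (X.rep w) g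
  have hP4 : 0 ≤ (C * q₃ ^ N) ^ 4 := by positivity
  have hQ : 0 ≤ X.quadMaj e (c₁ / (2 * R)) (X.rep w) g := X.quadMaj_nonneg _ _ _ _
  have hG : 0 ≤ ∏ k, X.gaussDefAt (c₁ / (2 * R)) (X.rep w k) :=
    Finset.prod_nonneg fun k _ => X.gaussDefAt_nonneg _ _
  have hprod0 : 0 ≤ ∏ k, m (X.rep w k) := Finset.prod_nonneg fun k _ => hm0 _
  calc ‖X.coefQ D.cf (loc N) (X.rep w)‖
      ≤ X.trSize (loc N) * ((C * q₃ ^ N) ^ 4 * ∏ k, m (X.rep w k)) := hmain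
    _ ≤ (Bs * qs ^ N) * ((C * q₃ ^ N) ^ 4 *
          (X.quadMaj e (c₁ / (2 * R)) (X.rep w) g * ∏ k, X.gaussDefAt (c₁ / (2 * R)) (X.rep w k))) :=
        mul_le_mul (hsz N) (mul_le_mul_of_nonneg_left hprod hP4) (mul_nonneg hP4 hprod0)
          (mul_nonneg hBs (pow_nonneg hqs N))
    _ = Bs * C ^ 4 * (qs * q₃ ^ 4) ^ N * X.quadMaj e (c₁ / (2 * R)) (X.rep w) g *
          ∏ k, X.gaussDefAt (c₁ / (2 * R)) (X.rep w k) := by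
        rw [mul_pow, mul_pow, ← pow_mul, ← pow_mul, mul_comm 4 N]
        ring

/-! ### 3. The majorant clause from a content-like factor, and from the content bound -/

/-- **The honest witness on the pair** (p676981's `hasCoefMajorant_of_content`): a content-like `κ` with the exact
`H`-Gaussian. -/
theorem hasCoefMajorantOn_of_content (D : X.ThetaData) {level : ℕ → X.Level} (loc : ∀ N, X.Tr (level N))
    (κ : (Fin 3 → X.E) → ℝ) {C q₃ A e e' : ℝ} (hC : 0 ≤ C) (hq₃ : 0 ≤ q₃) (hA : 0 ≤ A) (he' : 0 ≤ e')
    (hκ0 : ∀ x, 0 ≤ κ x)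
    (hcf : ∀ j x, ‖D.cf j x‖ ≤ C * κ x * X.gaussDef x)
    (hκΓ : ∀ γ ∈ X.Γ, ∀ x, κ (γ *ᵥ x) = κ x)
    (hκrep : ∀ N r, X.IsRepOf (loc N) r → ∀ x, κ (r *ᵥ x) ≤ q₃ ^ N * κ x)
    (hκpoly : ∀ x, κ x ≤ A * (1 + ‖X.ballCoord x‖) ^ e * X.defPoly e' x) :
    X.HasCoefMajorantOn D loc := by
  obtain ⟨c₁, K, hc₁, hK, hKx⟩ := X.exists_defPoly_mul_gaussDef_le_gaussDefAt e' he'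
  set M₀ : ℝ := max (A * K) 1 with hM₀
  have hM₀pos : 0 < M₀ := lt_of_lt_of_le zero_lt_one (le_max_right _ _)
  have hAK : A * K ≤ M₀ := le_max_left _ _
  refine ⟨fun x => κ x * X.gaussDef x / M₀, C * M₀, q₃, e, c₁, by positivity, hq₃, hc₁,
    fun x => div_nonneg (mul_nonneg (hκ0 x) (X.gaussDef_nonneg x)) hM₀pos.le, fun j x => ?_,
    fun γ hγ x => ?_, fun N r hr x => ?_, fun x => ?_⟩
  · calc ‖D.cf j x‖ ≤ C * κ x * X.gaussDef x := hcf j x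
      _ = C * M₀ * (κ x * X.gaussDef x / M₀) := by field_simp
  · simp only [hκΓ γ hγ x, X.gaussDef_mulVec_of_unitary (X.isUnitaryOf_of_mem_Γ hγ) x]
  · obtain ⟨h, _, k, t, ht, hrt⟩ := hr
    have hru : IsUnitaryOf X.c X.H r :=
      HeckeEquivariance.isUnitaryOf_of_isFor X (level N) (h.2 (X.slot k)) ht hrt
    dsimp only
    rw [X.gaussDef_mulVec_of_unitary hru x]
    have h1 := mul_le_mul_of_nonneg_right (hκrep N r ⟨h, ‹_›, k, t, ht, hrt⟩ x) (X.gaussDef_nonneg x)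
    calc κ (r *ᵥ x) * X.gaussDef x / M₀ ≤ q₃ ^ N * κ x * X.gaussDef x / M₀ :=
          div_le_div_of_nonneg_right h1 hM₀pos.le
      _ = q₃ ^ N * (κ x * X.gaussDef x / M₀) := by ring
  · have hpoly : 0 ≤ (1 + ‖X.ballCoord x‖) ^ e := Real.rpow_nonneg (by positivity) _
    have hg0 : 0 ≤ X.gaussDef x := X.gaussDef_nonneg x
    have h1 : κ x * X.gaussDef x ≤ A * (1 + ‖X.ballCoord x‖) ^ e * (X.defPoly e' x * X.gaussDef x) := by
      calc κ x * X.gaussDef x ≤ A * (1 + ‖X.ballCoord x‖) ^ e * X.defPoly e' x * X.gaussDef x :=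
            mul_le_mul_of_nonneg_right (hκpoly x) hg0
        _ = A * (1 + ‖X.ballCoord x‖) ^ e * (X.defPoly e' x * X.gaussDef x) := by ring
    have h2 : A * (1 + ‖X.ballCoord x‖) ^ e * (X.defPoly e' x * X.gaussDef x) ≤
        A * (1 + ‖X.ballCoord x‖) ^ e * (K * X.gaussDefAt c₁ x) :=
      mul_le_mul_of_nonneg_left (hKx x) (mul_nonneg hA hpoly)
    have hG : 0 ≤ X.gaussDefAt c₁ x := X.gaussDefAt_nonneg _ _
    calc κ x * X.gaussDef x / M₀ ≤ A * (1 + ‖X.ballCoord x‖) ^ e * (K * X.gaussDefAt c₁ x) / M₀ :=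
          div_le_div_of_nonneg_right (h1.trans h2) hM₀pos.le
      _ = (A * K / M₀) * ((1 + ‖X.ballCoord x‖) ^ e * X.gaussDefAt c₁ x) := by ring
      _ ≤ 1 * ((1 + ‖X.ballCoord x‖) ^ e * X.gaussDefAt c₁ x) :=
          mul_le_mul_of_nonneg_right ((div_le_one hM₀pos).mpr hAK) (mul_nonneg hpoly hG)
      _ = (1 + ‖X.ballCoord x‖) ^ e * X.gaussDefAt c₁ x := one_mul _

/-- The content norm under the representatives, from the depth clause on the pair. -/
theorem contentNorm_mulVec_le_of_repDenomOn
    (p : IsDedekindDomain.HeightOneSpectrum (RingOfIntegers X.E)) {level : ℕ → X.Level}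
    (loc : ∀ N, X.Tr (level N)) (hrep : X.RepDenomOn p loc) (N : ℕ) (r : Matrix (Fin 3) (Fin 3) X.E)
    (hr : X.IsRepOf (loc N) r) (x : Fin 3 → X.E) :
    X.contentNorm (r *ᵥ x) ≤ (Ideal.absNorm (p.asIdeal * X.conjIdeal p.asIdeal) : ℝ) ^ N * X.contentNorm x := by
  obtain ⟨r', hr', hent⟩ := hrep N r hr
  exact X.contentNorm_mulVec_le_of_inv_entries p N hr' hent x

/-- `κ = (1 + N(content))^{e′}` under the representatives, on the pair. -/
theorem kappa_mulVec_le_of_repDenomOn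
    (p : IsDedekindDomain.HeightOneSpectrum (RingOfIntegers X.E)) {level : ℕ → X.Level}
    (loc : ∀ N, X.Tr (level N)) (hrep : X.RepDenomOn p loc) {e' : ℝ} (he' : 0 ≤ e') (N : ℕ)
    (r : Matrix (Fin 3) (Fin 3) X.E) (hr : X.IsRepOf (loc N) r) (x : Fin 3 → X.E) :
    (1 + X.contentNorm (r *ᵥ x)) ^ e' ≤
      ((Ideal.absNorm (p.asIdeal * X.conjIdeal p.asIdeal) : ℝ) ^ e') ^ N * (1 + X.contentNorm x) ^ e' := by
  set q : ℝ := (Ideal.absNorm (p.asIdeal * X.conjIdeal p.asIdeal) : ℝ) with hq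
  have hq1 : 1 ≤ q := X.one_le_absNorm_depthPrime p
  have hq0 : 0 ≤ q := zero_le_one.trans hq1
  have hqN : 1 ≤ q ^ N := one_le_pow₀ hq1
  have hc := X.contentNorm_mulVec_le_of_repDenomOn p loc hrep N r hr x
  have hc0 := X.contentNorm_nonneg x
  have h1 : 1 + X.contentNorm (r *ᵥ x) ≤ q ^ N * (1 + X.contentNorm x) := by
    rw [← hq] at hc
    nlinarith
  calc (1 + X.contentNorm (r *ᵥ x)) ^ e' ≤ (q ^ N * (1 + X.contentNorm x)) ^ e' :=
        Real.rpow_le_rpow (by linarith [X.contentNorm_nonneg (r *ᵥ x)]) h1 he'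
    _ = (q ^ N) ^ e' * (1 + X.contentNorm x) ^ e' := Real.mul_rpow (by positivity) (by linarith)
    _ = (q ^ e') ^ N * (1 + X.contentNorm x) ^ e' := by
        congr 1
        rw [← Real.rpow_natCast q N, ← Real.rpow_mul hq0, ← Real.rpow_natCast (q ^ e') N,
          ← Real.rpow_mul hq0, mul_comm]

/-- **The majorant clause from the content bound and the depth clause, on the pair** (p677665 on `(level, loc)`). -/
theorem hasCoefMajorantOn_of_contentBound (D : X.ThetaData)
    (p : IsDedekindDomain.HeightOneSpectrum (RingOfIntegers X.E)) {level : ℕ → X.Level}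
    (loc : ∀ N, X.Tr (level N)) {C e' : ℝ} (hC : 0 ≤ C) (he' : 0 ≤ e') (hcf : X.ContentBound D C e')
    (hrep : X.RepDenomOn p loc) : X.HasCoefMajorantOn D loc := by
  have hq0 : 0 ≤ (Ideal.absNorm (p.asIdeal * X.conjIdeal p.asIdeal) : ℝ) :=
    zero_le_one.trans (X.one_le_absNorm_depthPrime p)
  refine X.hasCoefMajorantOn_of_content D loc (fun x => (1 + X.contentNorm x) ^ e')
    (C := C) (q₃ := (Ideal.absNorm (p.asIdeal * X.conjIdeal p.asIdeal) : ℝ) ^ e')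
    (A := (1 + (1 + X.sylvesterConst) ^ 2) ^ e') (e := 2 * e') (e' := e' / 2)
    hC (Real.rpow_nonneg hq0 _) (Real.rpow_nonneg (by positivity) _) (by positivity)
    (fun x => Real.rpow_nonneg (by linarith [X.contentNorm_nonneg x]) _) (fun j x => hcf j x)
    (fun γ hγ x => ?_) (fun N r hr x => X.kappa_mulVec_le_of_repDenomOn p loc hrep he' N r hr x)
    (fun x => X.kappa_le_poly he' x)
  simp only [X.contentNorm_mulVec_eq_of_mem_Γ hγ x]

/-! ### 4. The growth clause from the print's three clauses -/

/-- **`GrowthInvOn` FROM THE PRINT'S CLAUSES**: the size and depth of the localiser and the content bound on the theta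
coefficients give the growth clause that the family route consumes. -/
theorem growthInvOn_of_contentBound (D : X.ThetaData)
    (p : IsDedekindDomain.HeightOneSpectrum (RingOfIntegers X.E)) {level : ℕ → X.Level}
    (loc : ∀ N, X.Tr (level N)) (hsize : X.LocSizeOn loc) (hrep : X.RepDenomOn p loc)
    {C e' : ℝ} (hC : 0 ≤ C) (he' : 0 ≤ e') (hcf : X.ContentBound D C e') : X.GrowthInvOn D loc :=
  X.growthInvOn_of_coefMajorantOn D loc hsize (X.hasCoefMajorantOn_of_contentBound D p loc hC he' hcf hrep)

end T4Data

end Summit.Ventures.HodgeRepro.Tier4.Line3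

end
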